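import Literature.NumberTheory.Automorphic.JacquetGLFunctor
import Literature.NumberTheory.Automorphic.IwahoriDatumGL
import Literature.NumberTheory.Automorphic.LeviCompactQuotient
import Literature.NumberTheory.Automorphic.AdmissibleFiniteLength
import Literature.NumberTheory.Automorphic.ParabolicInductionSupportProofs
import Literature.NumberTheory.Automorphic.PAdicRepsJacquetAdmissibilityProofs
import HarnessLib

/-!
# Admissible representations of `GL_n(F)` generated by vectors of bounded level have finite length

**Theorem** (`isFiniteLength_of_isAdmissible_of_span_eq_top`; Bernstein–Zelevinsky 1976, §3.3
and Thm. 4.1 "finitely generated admissible representations have finite length"; Bernstein 1984 /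
Casselman 1995, Thm. 6.3.10). Let `π` be an admissible representation of `GL_n(F)` spanned by the
translates of a set of vectors fixed by a principal congruence subgroup `K = K_{|ϖ|^{j₀+1}}`. Then
`π` has finite length.

*Proof.* By the criterion `isFiniteLength_of_forall_lt_exists_avg_not_mem` it suffices that every
subquotient `A/B ≠ 0` of `π` has a non-zero `K`-fixed vector. Let `V₀ ⊆ A/B` be cyclic,
`d` a block labelling with the maximal number of blocks such that `r_d(V₀) ≠ 0`, and `ρ` an
irreducible quotient of the finitely generated `r_d(V₀)`; by maximality `ρ` is quasi-cuspidal,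
hence supercuspidal (Harish-Chandra) and admissible. By exactness of `r_d`, `ρ` is a quotient of
the subrepresentation `r_d(A₁) ≤ r_d(π)` (`A₁` the preimage of `V₀`), and `r_d(π)` is generated over
`L° = {|det_a| = 1}` by vectors fixed by finitely many conjugates of the Levi level `K^L`
(`JacquetGLGeneration`). The restriction of `ρ̃` to `L°` has a compact irreducible quotient `κ`
(`LeviCompactQuotient`), so the abstract level bound
(`exists_fixedPoints_ne_bot_of_compact_constituent`: projectivity of `κ` and duality) gives
`ρ^{l K^L l⁻¹} ≠ 0`, whence `ρ^{K^L} ≠ 0`, `r_d(V₀)^{K^L} ≠ 0`, and by Jacquet's first lemma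
(`fixedPoints_jacquetGL_le_map`) `V₀^{K} ≠ 0`. Theorems only; no named facts.

## References

* I. N. Bernstein, A. V. Zelevinsky, Russian Math. Surveys 31:3 (1976), §3.3, Thm. 4.1.
* I. N. Bernstein, A. V. Zelevinsky, Ann. Sci. ÉNS 10 (1977), §2, Thm. 2.8 and Remark 2.10.
* W. Casselman, *Introduction to the theory of admissible representations* (1995), Thm. 6.3.10.
-/

noncomputable section

open scoped MatrixGroups Pointwise

namespace Literature.NumberTheory.Automorphic

open Representation ValuativeRel Literature.NumberTheory.Automorphic.SmoothProjector
  Literature.RepresentationTheory.FiniteGroups Literature.RepresentationTheory.Semisimple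

variable {F : Type*} [Field F] [ValuativeRel F] [TopologicalSpace F] [IsNonarchimedeanLocalField F] {n : ℕ}

/-- Translating fixed vectors: `ρ(l⁻¹)` maps `V^{l K l⁻¹}` into `V^K`; in particular
`V^{l K l⁻¹} ≠ 0 → V^K ≠ 0`. [folklore] -/
theorem fixedPoints_ne_bot_of_conj {L W : Type*} [Group L] [AddCommGroup W] [Module ℂ W]
    (ρ : Representation ℂ L W) (K : Subgroup L) (l : L)
    (h : ρ.fixedPoints (K.map (MulAut.conj l).toMonoidHom) ≠ ⊥) : ρ.fixedPoints K ≠ ⊥ := by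
  obtain ⟨v, hv, hv0⟩ := Submodule.exists_mem_ne_zero_of_ne_bot h
  rw [Submodule.ne_bot_iff]
  refine ⟨ρ l⁻¹ v, ?_, fun h0 => hv0 ?_⟩
  · rw [mem_fixedPoints] at hv ⊢
    intro g hg
    have := hv (l * g * l⁻¹) ⟨g, hg, rfl⟩
    rw [← Module.End.mul_apply, ← map_mul, show g * l⁻¹ = l⁻¹ * (l * g * l⁻¹) by group, map_mul,
      Module.End.mul_apply, this]
  · have := congrArg (ρ l) h0
    rwa [map_zero, ← Module.End.mul_apply, ← map_mul, mul_inv_cancel, map_one, Module.End.one_apply] at this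

/-- Continuity of the block diagonal embedding (private copy of `continuous_blockDiagonalGL` of
`ParabolicSemidirect`, not imported because of its adelic dependencies). [folklore] -/
private theorem continuous_blockDiagonalGL₄ {r : ℕ} (c : Fin n → Fin r) : Continuous (blockDiagonalGL F c) := by
  haveI : IsTopologicalRing F := inferInstance
  have hval : Continuous fun m : (Π a, GL {i // c i = a} F) =>
      ((blockDiagonalGL F c m : GL (Fin n) F) : Matrix (Fin n) (Fin n) F) := by
    have h : Continuous fun m : (Π a, GL {i // c i = a} F) => fun a =>
        ((m a : GL {i // c i = a} F) : Matrix {i // c i = a} {i // c i = a} F) :=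
      continuous_pi fun a => Units.continuous_val.comp (continuous_apply a)
    refine continuous_matrix fun i j => ?_
    simp_rw [blockDiagonalGL_apply_coe]
    exact h.matrix_blockDiagonal'.matrix_elem _ _
  refine Units.continuous_iff.2 ⟨hval, ?_⟩
  have : (fun m : (Π a, GL {i // c i = a} F) =>
      (((blockDiagonalGL F c m)⁻¹ : GL (Fin n) F) : Matrix (Fin n) (Fin n) F)) =
        fun m => ((blockDiagonalGL F c m⁻¹ : GL (Fin n) F) : Matrix (Fin n) (Fin n) F) := by
    funext m
    rw [map_inv]
  rw [this]
  exact hval.comp continuous_inv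

/-- **Cuspidal exponents of a cyclic representation** (Bernstein–Zelevinsky 1977, §2.4–2.5;
1976, §3): a non-zero cyclic smooth representation `V₀` of `GL_n(F)` has a block labelling `d`
(monotone, with the maximal number of blocks such that `r_d(V₀) ≠ 0`) and a maximal
subrepresentation `N < r_d(V₀)` whose quotient is irreducible, admissible and supercuspidal.
[cite: BernsteinZelevinsky1977, Thm. 2.5] -/
theorem exists_supercuspidal_quotient_jacquetGL {W : Type*} [AddCommGroup W] [Module ℂ W] [Nontrivial W]
    (V0 : Representation ℂ (GL (Fin n) F) W) (hV₀s : V0.IsSmooth) {z₀ : W}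
    (hz₀gen : Submodule.span ℂ (Set.range fun g : GL (Fin n) F => V0 g z₀) = ⊤) :
    ∃ (r : ℕ) (d : Fin n → Fin r), Monotone d ∧ ∃ N : Subrepresentation (jacquetGL F d V0),
      N.quotientRep.IsIrreducible ∧ N.quotientRep.IsAdmissible ∧ N.quotientRep.IsSupercuspidal := by
  classical
  haveI : IsTopologicalRing F := inferInstance
  -- Step 1: a block labelling with the maximal number of blocks and `r_d(V₀) ≠ 0`
  let P : ℕ → Prop := fun r => ∃ d : Fin n → Fin r, Monotone d ∧ Function.Surjective d ∧
    Nontrivial (restrictUnipotentGL F d V0).Coinvariants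
  have hPle : ∀ r, P r → r ≤ n := by
    rintro r ⟨d, -, hds, -⟩
    simpa using Fintype.card_le_of_surjective d hds
  have hP : ∃ r, r ≤ n ∧ P r := by
    rcases Nat.eq_zero_or_pos n with hn | hn
    · subst hn
      refine ⟨0, le_rfl, Fin.elim0, fun i => Fin.elim0 i, fun i => Fin.elim0 i, ?_⟩
      exact nontrivial_coinvariants_of_forall_eq_one F _ (fun u => Subsingleton.elim _ _) V0
    · refine ⟨1, hn, fun _ => 0, fun _ _ _ => le_rfl, fun a => ⟨⟨0, hn⟩, ?_⟩, ?_⟩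
      · exact Subsingleton.elim _ _
      · exact nontrivial_coinvariants_of_forall_eq_one F _ (coe_eq_one_of_mem_unipotentRadicalP_const F) V0
  obtain ⟨r₀, hr₀n, hr₀⟩ := hP
  have hPmax : P (Nat.findGreatest P n) := Nat.findGreatest_spec hr₀n hr₀
  have hmax : ∀ r, P r → r ≤ Nat.findGreatest P n := fun r hr => Nat.le_findGreatest (hPle r hr) hr
  obtain ⟨d, hd, hds, hnt⟩ := hPmax
  haveI := hnt
  -- Step 2: an irreducible quotient `ρ` of the finitely generated `r_d(V₀)`
  haveI : Module.Finite (MonoidAlgebra ℂ (Π b, GL {i // d i = b} F)) (jacquetGL F d V0).asModule :=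
    finite_asModule_jacquetGL_of_span_orbit_eq_top hd V0 hV₀s hz₀gen
  obtain ⟨N, hN⟩ := exists_isCoatom_subrepresentation (ρ := jacquetGL F d V0)
  haveI hirr : N.quotientRep.IsIrreducible := Subrepresentation.isIrreducible_quotientRep hN
  have hρs : N.quotientRep.IsSmooth := (hV₀s.jacquetGL F d).quotientRep N
  -- Step 3: `ρ` is quasi-cuspidal (maximality), hence supercuspidal and admissible
  have hQC : ∀ p q : Fin n, p < q → d q = d p →
      Coinvariants.ker (N.quotientRep.comp (cutUnipotent F d p).subtype) = ⊤ := by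
    intro p q hpq hq
    refine coinvariantsKer_comp_cutUnipotent_eq_top F hd p V0 ?_ N.quotientRep N.mkQ N.mkQ_surjective
    by_contra hne
    have hnt' : Nontrivial (restrictUnipotentGL F (cutRefine d p) V0).Coinvariants := by
      change Nontrivial (W ⧸ Coinvariants.ker (restrictUnipotentGL F (cutRefine d p) V0))
      exact Submodule.Quotient.nontrivial_iff.2 hne
    have h := hmax (Nat.findGreatest P n + 1)
      ⟨cutRefine d p, cutRefine_monotone hd p, cutRefine_surjective hd hds hpq hq, hnt'⟩
    omega
  have hρsc : N.quotientRep.IsSupercuspidal := N.quotientRep.isSupercuspidal_of_forall_cut hd hρs hQC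
  haveI := sigmaCompactSpace_levi F d
  exact ⟨_, d, hd, N, hirr, IsSupercuspidal.isAdmissible_of_sigmaCompactSpace hρs hρsc, hρsc⟩

/-- **The level bound for cyclic subquotients** (the heart of Bernstein–Zelevinsky's finiteness
theorem, 1976 §3.3): let `π` be admissible and spanned by the translates of `s ⊆ π^{K}`,
`K = K_{|ϖ|^{j₀+1}}`; let `V₀` be a non-zero cyclic admissible representation which is a quotient
(`θ`) of a representation `U` embedding (`ι`) into `π`. Then `V₀^{K} ≠ 0`. [cite: BernsteinZelevinsky1977, Thm. 2.8 and Remark 2.10] -/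
theorem fixedPoints_ne_bot_of_cyclic_subquotient {V : Type*} [AddCommGroup V] [Module ℂ V]
    (π : Representation ℂ (GL (Fin n) F) V) (hπ : π.IsAdmissible) {ϖ : F} (hϖ0 : valuation F ϖ ≠ 0)
    (hϖ1 : valuation F ϖ < 1) (j₀ : ℕ) {s : Set V}
    (hsK : s ⊆ π.fixedPoints (congruenceGL n (valuation F ϖ ^ (j₀ + 1))))
    (hgen : Submodule.span ℂ {w | ∃ g : GL (Fin n) F, ∃ f ∈ s, w = π g f} = ⊤)
    {W : Type*} [AddCommGroup W] [Module ℂ W] [Nontrivial W] (V0 : Representation ℂ (GL (Fin n) F) W)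
    (hV₀ : V0.IsAdmissible) {z₀ : W} (hz₀gen : Submodule.span ℂ (Set.range fun g : GL (Fin n) F => V0 g z₀) = ⊤)
    {U : Type*} [AddCommGroup U] [Module ℂ U] {υ : Representation ℂ (GL (Fin n) F) U}
    (ι : υ.IntertwiningMap π) (hι : Function.Injective ι) (θ : υ.IntertwiningMap V0) (hθ : Function.Surjective θ) :
    V0.fixedPoints (congruenceGL n (valuation F ϖ ^ (j₀ + 1))) ≠ ⊥ := by
  classical
  haveI : IsTopologicalRing F := inferInstance
  have hKo : IsOpen ((congruenceGL n (valuation F ϖ ^ (j₀ + 1)) : Subgroup (GL (Fin n) F)) : Set (GL (Fin n) F)) :=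
    isOpen_congruenceGL (pow_ne_zero _ hϖ0)
  have hV₀s : V0.IsSmooth := hV₀.isSmooth
  -- Steps 1–3: a supercuspidal constituent `ρ = r_d(V₀)/N`
  obtain ⟨r, d, hd, N, hirr, hρa, hρsc⟩ := exists_supercuspidal_quotient_jacquetGL V0 hV₀s hz₀gen
  haveI := hirr
  have hY₀s : (jacquetGL F d V0).IsSmooth := hV₀s.jacquetGL F d
  have hρs : N.quotientRep.IsSmooth := hY₀s.quotientRep N
  -- Step 4: the compact irreducible `L°`-quotient `κ` of `ρ̃`
  obtain ⟨N', hκirr, hκa, hκsc⟩ := exists_irreducible_quotient_contragredient_leviDetOne F d N.quotientRep hρa hρsc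
  haveI := hκirr
  -- Step 5: `Z = r_d(π)` is generated over `L°` by vectors fixed by finitely many conjugate levels
  obtain ⟨R, hR⟩ := exists_finset_span_leviDetOne_jacquetGL_fixedPoints_eq_top_of_subset hd π hsK hgen
  have hZs : (jacquetGL F d π).IsSmooth := hπ.isSmooth.jacquetGL F d
  have hKLo : IsOpen (((congruenceGL n (valuation F ϖ ^ (j₀ + 1))).comap (blockDiagonalGL F d) :
      Subgroup (Π b, GL {i // d i = b} F)) : Set (Π b, GL {i // d i = b} F)) :=
    hKo.preimage (continuous_blockDiagonalGL₄ d)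
  have hKLc : IsCompact (((congruenceGL n (valuation F ϖ ^ (j₀ + 1))).comap (blockDiagonalGL F d) :
      Subgroup (Π b, GL {i // d i = b} F)) : Set (Π b, GL {i // d i = b} F)) :=
    (isCompact_leviIntegral F d).of_isClosed_subset (Subgroup.isClosed_of_isOpen _ hKLo)
      (comap_congruenceGL_le_leviIntegral (c := d) _)
  let Kf : ↥((R : Finset (Π b, GL {i // d i = b} F)) : Set (Π b, GL {i // d i = b} F)) → Subgroup (Π b, GL {i // d i = b} F) := fun l =>
    ((congruenceGL n (valuation F ϖ ^ (j₀ + 1))).comap (blockDiagonalGL F d)).map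
      (MulAut.conj (l : Π b, GL {i // d i = b} F)).toMonoidHom
  have hKfc : ∀ l, IsCompact ((Kf l : Subgroup (Π b, GL {i // d i = b} F)) : Set (Π b, GL {i // d i = b} F)) := by
    intro l
    change IsCompact ((fun x => (l : Π b, GL {i // d i = b} F) * x * (l : Π b, GL {i // d i = b} F)⁻¹) '' _)
    exact hKLc.image ((continuous_const.mul continuous_id).mul continuous_const)
  have hKfH : ∀ l, Kf l ≤ leviDetOne F d := by
    rintro l _ ⟨x, hx, rfl⟩
    exact (normal_leviDetOne (F := F) (c := d)).conj_mem _ (comap_congruenceGL_le_leviDetOne (c := d) _ hx) _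
  -- Step 6: `ρ` is a quotient of the subrepresentation `r_d(U) ≤ r_d(π)`
  have hjιinj : Function.Injective (jacquetGLMap F d ι) := jacquetGLMap_injective hd hπ.isSmooth ι hι
  let q : (jacquetGLMap F d ι).range.toRepresentation.IntertwiningMap N.quotientRep :=
    (N.mkQ.comp (jacquetGLMap F d θ)).comp ((jacquetGLMap F d ι).rangeInverse hjιinj)
  have hqsurj : Function.Surjective q :=
    (N.mkQ_surjective.comp (jacquetGLMap_surjective θ hθ)).comp ((jacquetGLMap F d ι).rangeInverse_surjective hjιinj)
  -- Step 7: the abstract level bound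
  obtain ⟨l, hl⟩ := exists_fixedPoints_ne_bot_of_compact_constituent (leviDetOne F d)
    (isOpen_leviIntegral F d) (isCompact_leviIntegral F d) leviIntegral_le_leviDetOne (isCompact_center_leviDetOne (c := d))
    hZs Kf hKfc hKfH hR hρs (jacquetGLMap F d ι).range q hqsurj hκa hκsc N'.mkQ N'.mkQ_surjective
  -- Step 8: unwind — `ρ^{K^L} ≠ 0`, `r_d(V₀)^{K^L} ≠ 0`, `V₀^{K} ≠ 0` (Jacquet's first lemma)
  have hρK := fixedPoints_ne_bot_of_conj _ _ _ hl
  have hY₀K : (jacquetGL F d V0).fixedPoints ((congruenceGL n (valuation F ϖ ^ (j₀ + 1))).comap (blockDiagonalGL F d)) ≠ ⊥ := by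
    intro hbot
    apply hρK
    rw [← map_fixedPoints_eq_of_surjective hY₀s N.mkQ N.mkQ_surjective hKLc, hbot, Submodule.map_bot]
  intro hbot
  apply hY₀K
  rw [eq_bot_iff]
  intro y hy
  obtain ⟨v, hv, rfl⟩ := fixedPoints_jacquetGL_le_map hd hϖ0 hϖ1 V0 hV₀ j₀ hy
  have hv' : v ∈ V0.fixedPoints (congruenceGL n (valuation F ϖ ^ (j₀ + 1))) := hv
  rw [hbot, Submodule.mem_bot] at hv'
  rw [hv', map_zero]
  exact Submodule.zero_mem _

/-- **Admissible representations of `GL_n(F)` generated by vectors of bounded level have finite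
length** (Bernstein–Zelevinsky 1976, §3.3 and Thm. 4.1; Casselman 1995, Thm. 6.3.10): if `π` is
admissible and spanned by the `GL_n(F)`-translates of a set `s ⊆ π^{K}`, `K = K_{|ϖ|^{j₀+1}}` a
principal congruence subgroup, then `π` has finite length as a `ℂ[GL_n(F)]`-module. See the module
docstring for the proof. [cite: BernsteinZelevinsky1977, Thm. 2.8 and Remark 2.10] -/
theorem isFiniteLength_of_isAdmissible_of_span_eq_top {V : Type*} [AddCommGroup V] [Module ℂ V]
    (π : Representation ℂ (GL (Fin n) F) V) (hπ : π.IsAdmissible) {ϖ : F} (hϖ0 : valuation F ϖ ≠ 0)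
    (hϖ1 : valuation F ϖ < 1) (j₀ : ℕ) {s : Set V}
    (hsK : s ⊆ π.fixedPoints (congruenceGL n (valuation F ϖ ^ (j₀ + 1))))
    (hgen : Submodule.span ℂ {w | ∃ g : GL (Fin n) F, ∃ f ∈ s, w = π g f} = ⊤) :
    IsFiniteLength (MonoidAlgebra ℂ (GL (Fin n) F)) π.asModule := by
  classical
  haveI : IsTopologicalRing F := inferInstance
  have hKo : IsOpen ((congruenceGL n (valuation F ϖ ^ (j₀ + 1)) : Subgroup (GL (Fin n) F)) : Set (GL (Fin n) F)) :=
    isOpen_congruenceGL (pow_ne_zero _ hϖ0)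
  have hKc : IsCompact ((congruenceGL n (valuation F ϖ ^ (j₀ + 1)) : Subgroup (GL (Fin n) F)) : Set (GL (Fin n) F)) :=
    isCompact_congruenceGL _
  refine isFiniteLength_of_forall_lt_exists_avg_not_mem hπ ⟨_, hKo⟩ hKc fun A B hBA => ?_
  change ∃ v ∈ A, avg π (congruenceGL n (valuation F ϖ ^ (j₀ + 1))) v ∉ B
  -- the subquotient `A/B` and a cyclic `V₀ ⊆ A/B`
  obtain ⟨a, haA, haB⟩ := SetLike.exists_of_lt hBA
  have hρA : A.toRepresentation.IsAdmissible := hπ.toRepresentation A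
  let BA : Subrepresentation A.toRepresentation :=
    ⟨B.toSubmodule.comap A.toSubmodule.subtype, fun g x hx => B.apply_mem_toSubmodule g hx⟩
  have hQ : BA.quotientRep.IsAdmissible := hρA.quotientRep BA
  have hx₀ : BA.mkQ ⟨a, haA⟩ ≠ 0 := fun h => haB ((BA.mkQ_eq_zero_iff _).1 h)
  let C : Subrepresentation BA.quotientRep := BA.quotientRep.orbitSpan (BA.mkQ ⟨a, haA⟩)
  have hV₀ : C.toRepresentation.IsAdmissible := hQ.toRepresentation C
  haveI hntC : Nontrivial C.toSubmodule :=
    ⟨⟨⟨_, BA.quotientRep.mem_orbitSpan_self (BA.mkQ ⟨a, haA⟩)⟩, 0, fun h => hx₀ (congrArg Subtype.val h)⟩⟩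
  -- `A₁`, the preimage of `V₀` in `A`, embeds into `π` and maps onto `V₀`
  let A₁ : Subrepresentation A.toRepresentation := BA.comapMkQ C
  let ι : A₁.toRepresentation.IntertwiningMap π :=
    (Subrepresentation.subtypeIntertwiningMap A).comp (Subrepresentation.subtypeIntertwiningMap A₁)
  have hιinj : Function.Injective ι :=
    (Subrepresentation.subtypeIntertwiningMap_injective A).comp (Subrepresentation.subtypeIntertwiningMap_injective A₁)
  let θ : A₁.toRepresentation.IntertwiningMap C.toRepresentation :=
    (BA.mkQ.comp (Subrepresentation.subtypeIntertwiningMap A₁)).codRestrictSubrep C (fun v => v.2)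
  have hθsurj : Function.Surjective θ := by
    refine IntertwiningMap.codRestrictSubrep_surjective _ C _ fun w hw => ?_
    obtain ⟨v, hv⟩ := BA.mkQ_surjective w
    exact ⟨⟨v, show BA.mkQ v ∈ C by rw [hv]; exact hw⟩, hv⟩
  -- a non-zero `K`-fixed vector of `V₀`
  have hkey := fixedPoints_ne_bot_of_cyclic_subquotient π hπ hϖ0 hϖ1 j₀ hsK hgen C.toRepresentation hV₀
    (BA.quotientRep.span_orbit_orbitSpan_eq_top (BA.mkQ ⟨a, haA⟩)) ι hιinj θ hθsurj
  obtain ⟨x, hxK, hx0⟩ := Submodule.exists_mem_ne_zero_of_ne_bot hkey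
  obtain ⟨a', ha'⟩ := BA.mkQ_surjective (x : A.toSubmodule ⧸ BA.toSubmodule)
  refine ⟨(a' : V), a'.2, fun havg => hx0 ?_⟩
  have h1 : ((avg A.toRepresentation (congruenceGL n (valuation F ϖ ^ (j₀ + 1))) a' : A.toSubmodule) : V) =
      avg π (congruenceGL n (valuation F ϖ ^ (j₀ + 1))) (a' : V) :=
    map_avg hKc (Subrepresentation.subtypeIntertwiningMap A) (hρA.isSmooth a')
  have h2 : avg A.toRepresentation (congruenceGL n (valuation F ϖ ^ (j₀ + 1))) a' ∈ BA := by
    change ((avg A.toRepresentation (congruenceGL n (valuation F ϖ ^ (j₀ + 1))) a' : A.toSubmodule) : V) ∈ B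
    rw [h1]
    exact havg
  have h3 : BA.mkQ (avg A.toRepresentation (congruenceGL n (valuation F ϖ ^ (j₀ + 1))) a') =
      avg BA.quotientRep (congruenceGL n (valuation F ϖ ^ (j₀ + 1))) (BA.mkQ a') :=
    map_avg hKc BA.mkQ (hρA.isSmooth a')
  have hxQ : (x : A.toSubmodule ⧸ BA.toSubmodule) ∈ BA.quotientRep.fixedPoints (congruenceGL n (valuation F ϖ ^ (j₀ + 1))) := by
    rw [mem_fixedPoints] at hxK ⊢
    intro g hg
    exact congrArg Subtype.val (hxK g hg)
  apply Subtype.ext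
  change (x : A.toSubmodule ⧸ BA.toSubmodule) = 0
  rw [← avg_eq_self_of_mem_fixedPoints hxQ, ← ha', ← h3, (BA.mkQ_eq_zero_iff _).2 h2]

end Literature.NumberTheory.Automorphic
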